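/-
Copyright: the b2b-balaban T⁴-continuum CRUX team, row NE7b OWNER lineage `t4-ne7b-p1` (gen 138). Project licence.
-/
import Summits.QuantumFields.BalabanUV.T4Continuum.Spine.NE7b.SupBlockHessianKernelAverage
import Summits.QuantumFields.BalabanUV.T4Continuum.Spine.NE7b.SupBlockEffectiveActionCovariance

/-!
# THE OUTPUT HESSIAN'S KERNEL LETTER SPLITS INTO «INPUT LETTER + COVARIANCE KERNEL LETTER» — SCOPING (d10)(1) COMPLETED: by the covariance
# formula (403) read at the coordinate directions `e_x, e_y`, `HessW(ψ)_{xy} = A_{xy}(ψ) − C_{xy}(ψ)` with the tilted AVERAGE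
# `A_{xy} = Z⁻¹∫e^{−U}U″[e_x,e_y]` and the tilted COVARIANCE `C_{xy} = Z⁻¹∫e^{−U}U′[e_x]U′[e_y] − Z⁻²(∫e^{−U}U′[e_x])(∫e^{−U}U′[e_y])`; (437)
# bounds the rows of `A` by the INPUT's row-sum letter `κr`, so `Σ_y |HessW(ψ)_{xy}| ≤ κr + Σ_y |C_{xy}(ψ)|` for every `ψ, x` — the ONE
# quantity the road must now bound is the row sum of the tilted covariance kernel (the Helffer–Sjöstrand ∕ cluster-expansion half, (d10)(2))
# (row NE7b, node U5c; (403), (437) BY NAME; [folklore])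

Cell `pub-balaban`, sub-cell `t4`, spine estimate NE7b (`T4WeightBudget.RelWeightBound`; the cell's OWN estimate — NOT PRINTED in
[Bałaban 1983–89], NOT PROVED).  Crux-route work under `Spine/NE7b/` by the row OWNER (`t4-ne7b-p1` gen 138, file (439)) under FREEZE
(0)'s crux-prover clause; NOTHING of Bałaban's is named as a Lean object, valued or asserted; no `T4Continuum/Support` leaf typed; no
`def`, no notation; zero `sorry`.  Imports (BY NAME): (437) `…SupBlockHessianKernelAverage` (`tilted_hessian_average_rowsum`,
`integrable_weighted_hessian_entry`), (403) `…SupBlockEffectiveActionCovariance` (`hessian_block_neg_log_apply`, `integrable_weightedBlockHess`).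

WHAT IS PROVED ([folklore]; `e_x = EuclideanSpace.single x 1`; `Z, A, C` written out):
* §1 `integrable_weighted_gradient_product` (`ω ↦ e^{−U(ω+ψ)}·U′(ω+ψ)[e_x]·U′(ω+ψ)[e_y]` is integrable under the regulator — the difference of
  (403)'s weighted second piece and (437)'s weighted Hessian entry), `hessian_entry_split` (the scalar covariance formula at `e_x, e_y` as
  `A_{xy} − C_{xy}`).
* §2 **`hessian_kernel_rowsum_split`**: `Σ_y |HessW(ψ)[e_x,e_y]| ≤ κr + Σ_y |C_{xy}(ψ)|` for every background `ψ` and site `x`, where `HessW(ψ)`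
  is (402)∕(403)'s Hessian continuous bilinear map and `κr` the input's row-sum letter `Σ_y|U″(φ)[e_x,e_y]| ≤ κr`.
* §3 toy: none needed beyond (437)'s (the file is a two-step assembly).

HONEST (what this is NOT).  No bound on `Σ_y |C_{xy}|` is claimed: Cauchy–Schwarz with (423) gives only the ENTRYWISE `|C_{xy}| ≤ κ₂²∕(m−λ)`,
whose row sum is extensive in the block (`|Y|κ₂²∕(m−λ)`) — useless for iteration; a summable-decay bound is the located crux ((d10)(2): the
Helffer–Sjöstrand random-walk representation for single-site inputs [acq-09095], the cluster expansion for block inputs).  Scalar skeleton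
((A3), NC-NE7b-α UNRULED); nothing of Bałaban's asserted.  BY-NAME EFFECT ON THE WALL: NONE.  NE7b NOT PRINTED ∕ NOT PROVED; spine PROVED
0∕9; rung (B)+1 — the programme's measures remain FINITE-torus statements; NOT the mass gap, NOT Clay.  HONEST DEPENDENCY: continuum YM
on T⁴ ⇐ BetaPertH ∧ nine spine estimates (0∕9 proved); BetaPertH ⇐ (D1) ∧ (D4) ∧ CAP+tail; G-an2-4 gates asym, D1 and NE2∕3∕4.
-/

set_option autoImplicit false
set_option maxSynthPendingDepth 2

noncomputable section

namespace Summit.QuantumFields.BalabanUV.T4Continuum.NE7b.SupBlockHessianKernelSplit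

open MeasureTheory ProbabilityTheory Finset Real
open scoped BigOperators Matrix
open SupBlockHessianKernelAverage (tilted_hessian_average_rowsum integrable_weighted_hessian_entry)
open SupBlockEffectiveActionCovariance (hessian_block_neg_log_apply integrable_weightedBlockHess)

variable {ι : Type} [Fintype ι] [DecidableEq ι]

variable {Γ : Matrix ι ι ℝ} {γop : ℝ} {U : EuclideanSpace ℝ ι → ℝ} {U' : EuclideanSpace ℝ ι → EuclideanSpace ℝ ι →L[ℝ] ℝ}
  {U'' : EuclideanSpace ℝ ι → EuclideanSpace ℝ ι →L[ℝ] EuclideanSpace ℝ ι →L[ℝ] ℝ} {κ₀ κ₁ κ₂ κr a τ δ θ : ℝ}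

/-! ## §1. The product term and the scalar split -/

/-- **The weighted gradient product is integrable**: `ω ↦ e^{−U(ω+ψ)}·U′(ω+ψ)[e_x]·U′(ω+ψ)[e_y]` under the regulator (as the weighted Hessian
entry of (437) minus (403)'s weighted second piece read at `e_x, e_y`). [folklore] -/
theorem integrable_weighted_gradient_product (hΓ : Γ.PosSemidef) (hΓop : (γop • (1 : Matrix ι ι ℝ) - Γ).PosSemidef) (Y : Finset ι)
    (hUd : ∀ φ : EuclideanSpace ℝ ι, HasFDerivAt U (U' φ) φ) (hU'd : ∀ φ : EuclideanSpace ℝ ι, HasFDerivAt U' (U'' φ) φ)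
    (hU''c : Continuous U'') (hκ₀ : 0 ≤ κ₀) (hκ₁ : 0 ≤ κ₁) (ha : 0 ≤ a) (hκ₂ : 0 ≤ κ₂) (hτ : 0 < τ) (hδ : 0 < δ) (hθ0 : 0 < θ) (hθ1 : θ < 1)
    (hκθ : (2 * κ₀ * (1 + τ) + 4 * δ) * γop ≤ θ) (hstab : ∀ φ : EuclideanSpace ℝ ι, -(κ₀ * ∑ x ∈ Y, φ x ^ 2) ≤ U φ)
    (hU'b : ∀ φ : EuclideanSpace ℝ ι, ‖U' φ‖ ≤ κ₁ * (a + ∑ x ∈ Y, φ x ^ 2)) (hU''b : ∀ φ : EuclideanSpace ℝ ι, ‖U'' φ‖ ≤ κ₂)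
    (ψ : EuclideanSpace ℝ ι) (x y : ι) :
    Integrable (fun ω : EuclideanSpace ℝ ι => exp (-U (ω + ψ)) *
      (U' (ω + ψ) (EuclideanSpace.single x (1 : ℝ)) * U' (ω + ψ) (EuclideanSpace.single y (1 : ℝ)))) (multivariateGaussian 0 Γ) := by
  have hH := integrable_weighted_hessian_entry hΓ hΓop Y hUd hU''c hκ₀ hτ hδ hθ0 hθ1 hκθ hstab hU''b ψ x y
  have hW := integrable_weightedBlockHess hΓ hΓop Y hUd hU'd hU''c hκ₀ hκ₁ ha hκ₂ hτ hδ hθ1 hκθ hstab hU'b hU''b ψ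
  have hW' := ((ContinuousLinearMap.apply ℝ ℝ (EuclideanSpace.single y (1 : ℝ))).comp
    (ContinuousLinearMap.apply ℝ (EuclideanSpace ℝ ι →L[ℝ] ℝ) (EuclideanSpace.single x (1 : ℝ)))).integrable_comp hW
  have hW'' : Integrable (fun ω : EuclideanSpace ℝ ι => exp (-U (ω + ψ)) *
      (U'' (ω + ψ) (EuclideanSpace.single x (1 : ℝ)) (EuclideanSpace.single y (1 : ℝ)) -
        U' (ω + ψ) (EuclideanSpace.single x (1 : ℝ)) * U' (ω + ψ) (EuclideanSpace.single y (1 : ℝ)))) (multivariateGaussian 0 Γ) := by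
    refine hW'.congr (ae_of_all _ fun ω => ?_)
    simp only [Function.comp_apply, ContinuousLinearMap.coe_comp, ContinuousLinearMap.apply_apply, _root_.smul_apply, _root_.sub_apply,
      smul_eq_mul, ContinuousLinearMap.smulRight_apply]
  refine (hH.sub hW'').congr (ae_of_all _ fun ω => ?_)
  simp only [Pi.sub_apply]
  ring

/-- **The scalar covariance formula at the coordinate directions, split as AVERAGE − COVARIANCE**: (403)'s right-hand side at `e_x, e_y`
equals `A_{xy} − C_{xy}`. [folklore] -/
theorem hessian_entry_split (hΓ : Γ.PosSemidef) (hΓop : (γop • (1 : Matrix ι ι ℝ) - Γ).PosSemidef) (Y : Finset ι)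
    (hUd : ∀ φ : EuclideanSpace ℝ ι, HasFDerivAt U (U' φ) φ) (hU'd : ∀ φ : EuclideanSpace ℝ ι, HasFDerivAt U' (U'' φ) φ)
    (hU''c : Continuous U'') (hκ₀ : 0 ≤ κ₀) (hκ₁ : 0 ≤ κ₁) (ha : 0 ≤ a) (hκ₂ : 0 ≤ κ₂) (hτ : 0 < τ) (hδ : 0 < δ) (hθ0 : 0 < θ) (hθ1 : θ < 1)
    (hκθ : (2 * κ₀ * (1 + τ) + 4 * δ) * γop ≤ θ) (hstab : ∀ φ : EuclideanSpace ℝ ι, -(κ₀ * ∑ x ∈ Y, φ x ^ 2) ≤ U φ)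
    (hU'b : ∀ φ : EuclideanSpace ℝ ι, ‖U' φ‖ ≤ κ₁ * (a + ∑ x ∈ Y, φ x ^ 2)) (hU''b : ∀ φ : EuclideanSpace ℝ ι, ‖U'' φ‖ ≤ κ₂)
    (ψ : EuclideanSpace ℝ ι) (x y : ι) :
    (∫ ω : EuclideanSpace ℝ ι, exp (-U (ω + ψ)) ∂(multivariateGaussian 0 Γ))⁻¹ * (∫ ω : EuclideanSpace ℝ ι, exp (-U (ω + ψ)) * (U'' (ω + ψ) (EuclideanSpace.single x (1 :
        ℝ)) (EuclideanSpace.single y (1 : ℝ)) - U' (ω + ψ) (EuclideanSpace.single x (1 : ℝ)) * U' (ω + ψ) (EuclideanSpace.single y (1 : ℝ))) ∂(multivariateGaussian 0 Γ))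
        + ((∫ ω : EuclideanSpace ℝ ι, exp (-U (ω + ψ)) ∂(multivariateGaussian 0 Γ)) ^ 2)⁻¹ * ((∫ ω : EuclideanSpace ℝ ι, exp (-U (ω + ψ)) * U' (ω + ψ)
        (EuclideanSpace.single x (1 : ℝ)) ∂(multivariateGaussian 0 Γ)) * (∫ ω : EuclideanSpace ℝ ι, exp (-U (ω + ψ)) * U' (ω + ψ) (EuclideanSpace.single y (1 : ℝ))
        ∂(multivariateGaussian 0 Γ))) =
      (∫ ω : EuclideanSpace ℝ ι, exp (-U (ω + ψ)) ∂(multivariateGaussian 0 Γ))⁻¹ * (∫ ω : EuclideanSpace ℝ ι, exp (-U (ω + ψ)) * U'' (ω + ψ) (EuclideanSpace.single x (1 :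
          ℝ)) (EuclideanSpace.single y (1 : ℝ)) ∂(multivariateGaussian 0 Γ)) - ((∫ ω : EuclideanSpace ℝ ι, exp (-U (ω + ψ)) ∂(multivariateGaussian 0 Γ))⁻¹ * (∫ ω :
          EuclideanSpace ℝ ι, exp (-U (ω + ψ)) * (U' (ω + ψ) (EuclideanSpace.single x (1 : ℝ)) * U' (ω + ψ) (EuclideanSpace.single y (1 : ℝ))) ∂(multivariateGaussian 0
          Γ)) - ((∫ ω : EuclideanSpace ℝ ι, exp (-U (ω + ψ)) ∂(multivariateGaussian 0 Γ)) ^ 2)⁻¹ * ((∫ ω : EuclideanSpace ℝ ι, exp (-U (ω + ψ)) * U' (ω + ψ)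
          (EuclideanSpace.single x (1 : ℝ)) ∂(multivariateGaussian 0 Γ)) * (∫ ω : EuclideanSpace ℝ ι, exp (-U (ω + ψ)) * U' (ω + ψ) (EuclideanSpace.single y (1 : ℝ))
          ∂(multivariateGaussian 0 Γ)))) := by
  have hH := integrable_weighted_hessian_entry hΓ hΓop Y hUd hU''c hκ₀ hτ hδ hθ0 hθ1 hκθ hstab hU''b ψ x y
  have hP := integrable_weighted_gradient_product hΓ hΓop Y hUd hU'd hU''c hκ₀ hκ₁ ha hκ₂ hτ hδ hθ0 hθ1 hκθ hstab hU'b hU''b ψ x y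
  have hsplit : (∫ ω : EuclideanSpace ℝ ι, exp (-U (ω + ψ)) * (U'' (ω + ψ) (EuclideanSpace.single x (1 : ℝ)) (EuclideanSpace.single y (1 : ℝ)) - U' (ω + ψ)
      (EuclideanSpace.single x (1 : ℝ)) * U' (ω + ψ) (EuclideanSpace.single y (1 : ℝ))) ∂(multivariateGaussian 0 Γ)) =
      (∫ ω : EuclideanSpace ℝ ι, exp (-U (ω + ψ)) * U'' (ω + ψ) (EuclideanSpace.single x (1 : ℝ)) (EuclideanSpace.single y (1 : ℝ)) ∂(multivariateGaussian 0 Γ)) - (∫ ω :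
          EuclideanSpace ℝ ι, exp (-U (ω + ψ)) * (U' (ω + ψ) (EuclideanSpace.single x (1 : ℝ)) * U' (ω + ψ) (EuclideanSpace.single y (1 : ℝ))) ∂(multivariateGaussian 0
          Γ)) := by
    rw [← integral_sub hH hP]
    refine integral_congr_ae (ae_of_all _ fun ω => ?_)
    ring
  rw [hsplit]
  ring

/-! ## §2. The split of the output Hessian's kernel letter -/

/-- **THE OUTPUT HESSIAN KERNEL'S ROW SUMS SPLIT**: for the block class with the input row-sum letter `Σ_y|U″(φ)[e_x,e_y]| ≤ κr`, at every
background `ψ` and site `x`, (402)∕(403)'s Hessian of `W = −log Z` satisfies `Σ_y |HessW(ψ)[e_x,e_y]| ≤ κr + Σ_y |C_{xy}(ψ)|`, `C` the tilted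
covariance kernel of the input gradient's components (written out). [folklore] -/
theorem hessian_kernel_rowsum_split (hΓ : Γ.PosSemidef) (hΓop : (γop • (1 : Matrix ι ι ℝ) - Γ).PosSemidef) (Y : Finset ι)
    (hUd : ∀ φ : EuclideanSpace ℝ ι, HasFDerivAt U (U' φ) φ) (hU'd : ∀ φ : EuclideanSpace ℝ ι, HasFDerivAt U' (U'' φ) φ)
    (hU''c : Continuous U'') (hκ₀ : 0 ≤ κ₀) (hκ₁ : 0 ≤ κ₁) (ha : 0 ≤ a) (hκ₂ : 0 ≤ κ₂) (hτ : 0 < τ) (hδ : 0 < δ) (hθ0 : 0 < θ) (hθ1 : θ < 1)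
    (hκθ : (2 * κ₀ * (1 + τ) + 4 * δ) * γop ≤ θ) (hstab : ∀ φ : EuclideanSpace ℝ ι, -(κ₀ * ∑ x ∈ Y, φ x ^ 2) ≤ U φ)
    (hU'b : ∀ φ : EuclideanSpace ℝ ι, ‖U' φ‖ ≤ κ₁ * (a + ∑ x ∈ Y, φ x ^ 2)) (hU''b : ∀ φ : EuclideanSpace ℝ ι, ‖U'' φ‖ ≤ κ₂)
    (hU''row : ∀ (φ : EuclideanSpace ℝ ι) (x : ι), ∑ y, |U'' φ (EuclideanSpace.single x (1 : ℝ)) (EuclideanSpace.single y (1 : ℝ))| ≤ κr)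
    (ψ : EuclideanSpace ℝ ι) (x : ι) :
    ∑ y, |((∫ ω : EuclideanSpace ℝ ι, exp (-U (ω + ψ)) ∂(multivariateGaussian 0 Γ))⁻¹ • (∫ ω : EuclideanSpace ℝ ι, exp (-U (ω + ψ)) • (U'' (ω + ψ) - (U' (ω +
        ψ)).smulRight (U' (ω + ψ))) ∂(multivariateGaussian 0 Γ)) + (((∫ ω : EuclideanSpace ℝ ι, exp (-U (ω + ψ)) ∂(multivariateGaussian 0 Γ)) ^ 2)⁻¹ • ∫ ω :
        EuclideanSpace ℝ ι, exp (-U (ω + ψ)) • U' (ω + ψ) ∂(multivariateGaussian 0 Γ)).smulRight (∫ ω : EuclideanSpace ℝ ι, exp (-U (ω + ψ)) • U' (ω + ψ)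
        ∂(multivariateGaussian 0 Γ))) (EuclideanSpace.single x (1 : ℝ)) (EuclideanSpace.single y (1 : ℝ))| ≤
      κr + ∑ y, |((∫ ω : EuclideanSpace ℝ ι, exp (-U (ω + ψ)) ∂(multivariateGaussian 0 Γ))⁻¹ * (∫ ω : EuclideanSpace ℝ ι, exp (-U (ω + ψ)) * (U' (ω + ψ)
          (EuclideanSpace.single x (1 : ℝ)) * U' (ω + ψ) (EuclideanSpace.single y (1 : ℝ))) ∂(multivariateGaussian 0 Γ)) - ((∫ ω : EuclideanSpace ℝ ι, exp (-U (ω + ψ))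
          ∂(multivariateGaussian 0 Γ)) ^ 2)⁻¹ * ((∫ ω : EuclideanSpace ℝ ι, exp (-U (ω + ψ)) * U' (ω + ψ) (EuclideanSpace.single x (1 : ℝ)) ∂(multivariateGaussian 0 Γ)) *
          (∫ ω : EuclideanSpace ℝ ι, exp (-U (ω + ψ)) * U' (ω + ψ) (EuclideanSpace.single y (1 : ℝ)) ∂(multivariateGaussian 0 Γ))))| := by
  have hA := tilted_hessian_average_rowsum hΓ hΓop Y hUd hU''c hκ₀ hτ hδ hθ0 hθ1 hκθ hstab hU''b hU''row ψ x
  -- rewrite each entry by the covariance formula and split it as `A_{xy} − C_{xy}`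
  have hentry : ∀ y, ((∫ ω : EuclideanSpace ℝ ι, exp (-U (ω + ψ)) ∂(multivariateGaussian 0 Γ))⁻¹ • (∫ ω : EuclideanSpace ℝ ι, exp (-U (ω + ψ)) • (U'' (ω + ψ) - (U' (ω +
      ψ)).smulRight (U' (ω + ψ))) ∂(multivariateGaussian 0 Γ)) + (((∫ ω : EuclideanSpace ℝ ι, exp (-U (ω + ψ)) ∂(multivariateGaussian 0 Γ)) ^ 2)⁻¹ • ∫ ω : EuclideanSpace
      ℝ ι, exp (-U (ω + ψ)) • U' (ω + ψ) ∂(multivariateGaussian 0 Γ)).smulRight (∫ ω : EuclideanSpace ℝ ι, exp (-U (ω + ψ)) • U' (ω + ψ) ∂(multivariateGaussian 0 Γ)))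
      (EuclideanSpace.single x (1 : ℝ)) (EuclideanSpace.single y (1 : ℝ)) =
      (∫ ω : EuclideanSpace ℝ ι, exp (-U (ω + ψ)) ∂(multivariateGaussian 0 Γ))⁻¹ * (∫ ω : EuclideanSpace ℝ ι, exp (-U (ω + ψ)) * U'' (ω + ψ) (EuclideanSpace.single x (1 :
          ℝ)) (EuclideanSpace.single y (1 : ℝ)) ∂(multivariateGaussian 0 Γ)) - ((∫ ω : EuclideanSpace ℝ ι, exp (-U (ω + ψ)) ∂(multivariateGaussian 0 Γ))⁻¹ * (∫ ω :
          EuclideanSpace ℝ ι, exp (-U (ω + ψ)) * (U' (ω + ψ) (EuclideanSpace.single x (1 : ℝ)) * U' (ω + ψ) (EuclideanSpace.single y (1 : ℝ))) ∂(multivariateGaussian 0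
          Γ)) - ((∫ ω : EuclideanSpace ℝ ι, exp (-U (ω + ψ)) ∂(multivariateGaussian 0 Γ)) ^ 2)⁻¹ * ((∫ ω : EuclideanSpace ℝ ι, exp (-U (ω + ψ)) * U' (ω + ψ)
          (EuclideanSpace.single x (1 : ℝ)) ∂(multivariateGaussian 0 Γ)) * (∫ ω : EuclideanSpace ℝ ι, exp (-U (ω + ψ)) * U' (ω + ψ) (EuclideanSpace.single y (1 : ℝ))
          ∂(multivariateGaussian 0 Γ)))) := by
    intro y
    rw [hessian_block_neg_log_apply hΓ hΓop Y hUd hU'd hU''c hκ₀ hκ₁ ha hκ₂ hτ hδ hθ1 hκθ hstab hU'b hU''b ψ _ _]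
    exact hessian_entry_split hΓ hΓop Y hUd hU'd hU''c hκ₀ hκ₁ ha hκ₂ hτ hδ hθ0 hθ1 hκθ hstab hU'b hU''b ψ x y
  simp only [hentry]
  calc ∑ y, |(∫ ω : EuclideanSpace ℝ ι, exp (-U (ω + ψ)) ∂(multivariateGaussian 0 Γ))⁻¹ * (∫ ω : EuclideanSpace ℝ ι, exp (-U (ω + ψ)) * U'' (ω + ψ) (EuclideanSpace.single
      x (1 : ℝ)) (EuclideanSpace.single y (1 : ℝ)) ∂(multivariateGaussian 0 Γ)) - ((∫ ω : EuclideanSpace ℝ ι, exp (-U (ω + ψ)) ∂(multivariateGaussian 0 Γ))⁻¹ * (∫ ω :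
      EuclideanSpace ℝ ι, exp (-U (ω + ψ)) * (U' (ω + ψ) (EuclideanSpace.single x (1 : ℝ)) * U' (ω + ψ) (EuclideanSpace.single y (1 : ℝ))) ∂(multivariateGaussian 0 Γ)) -
      ((∫ ω : EuclideanSpace ℝ ι, exp (-U (ω + ψ)) ∂(multivariateGaussian 0 Γ)) ^ 2)⁻¹ * ((∫ ω : EuclideanSpace ℝ ι, exp (-U (ω + ψ)) * U' (ω + ψ) (EuclideanSpace.single
      x (1 : ℝ)) ∂(multivariateGaussian 0 Γ)) * (∫ ω : EuclideanSpace ℝ ι, exp (-U (ω + ψ)) * U' (ω + ψ) (EuclideanSpace.single y (1 : ℝ)) ∂(multivariateGaussian 0 Γ))))|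
      ≤ ∑ y, (|(∫ ω : EuclideanSpace ℝ ι, exp (-U (ω + ψ)) ∂(multivariateGaussian 0 Γ))⁻¹ * (∫ ω : EuclideanSpace ℝ ι, exp (-U (ω + ψ)) * U'' (ω + ψ)
          (EuclideanSpace.single x (1 : ℝ)) (EuclideanSpace.single y (1 : ℝ)) ∂(multivariateGaussian 0 Γ))| + |((∫ ω : EuclideanSpace ℝ ι, exp (-U (ω + ψ))
          ∂(multivariateGaussian 0 Γ))⁻¹ * (∫ ω : EuclideanSpace ℝ ι, exp (-U (ω + ψ)) * (U' (ω + ψ) (EuclideanSpace.single x (1 : ℝ)) * U' (ω + ψ) (EuclideanSpace.single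
          y (1 : ℝ))) ∂(multivariateGaussian 0 Γ)) - ((∫ ω : EuclideanSpace ℝ ι, exp (-U (ω + ψ)) ∂(multivariateGaussian 0 Γ)) ^ 2)⁻¹ * ((∫ ω : EuclideanSpace ℝ ι, exp
          (-U (ω + ψ)) * U' (ω + ψ) (EuclideanSpace.single x (1 : ℝ)) ∂(multivariateGaussian 0 Γ)) * (∫ ω : EuclideanSpace ℝ ι, exp (-U (ω + ψ)) * U' (ω + ψ)
          (EuclideanSpace.single y (1 : ℝ)) ∂(multivariateGaussian 0 Γ))))|) :=
        Finset.sum_le_sum fun y _ => abs_sub _ _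
    _ ≤ _ := by
        rw [Finset.sum_add_distrib]
        exact add_le_add hA le_rfl

end Summit.QuantumFields.BalabanUV.T4Continuum.NE7b.SupBlockHessianKernelSplit

end
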